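import Literature.Analysis.FunctionSpaces.SpinorWightmanVanishing
import Literature.MathematicalPhysics.QuantumLattice.ForwardTubeTwoPoint
import HarnessLib

/-!
# Two-point functions of spinor Wightman theories: covariance under `SL(2, ℂ)`

Topic `Literature/Analysis/FunctionSpaces`, third spinor file of the proof of the spin–statistics
theorem `Literature.Analysis.FunctionSpaces.spin_statistics` (Streater–Wightman (1964), §4-4,
Thm. 4-10). For a spinor theory `IsSpinorWightmanQFT W` and two component letters `i, j` we study
the two-point distribution `hW.twoPt i j = ⟪Ω, φ_i(x₀) φ_j(x₁) Ω⟫` (the case `n = 2`, `Ψ = Ω` of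
`SpinorWightmanDistributions`):

* `twoPt_apply_tensor`, `twoPt_transl` (translation invariance, W2' at `A = 1` and `U(a)Ω = Ω`);
* `cfield_adj_adj` (`φ_{i††} = φ_i` on `D`), `inner_cfield_adj`, and the **transformation law
  of the adjoint components** `spinRep_cfield_adj`:
  `U(0,A) φ_{(k,α)†}(f) ψ = ∑_β conj(S^{(k)}(A⁻¹)_{αβ}) φ_{(k,β)†}(Λ(A) • f) U(0,A) ψ`
  (from W2' for `φ_{k,α}`, unitarity of `U(0, A)` and density of `D`; Streater–Wightman §3-1:
  `φ*` transforms under the complex conjugate representation);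
* the **covariance of the two-point distributions** `twoPt_cov`
  (S–W eq. (3-26) for the pair `(φ_{k,α}, φ_{(k,γ)†})`):
  `⟪Ω, φ_α(f) φ_{γ†}(g) Ω⟫ = ∑_{β,δ} S(A⁻¹)_{αβ} conj(S(A⁻¹)_{γδ}) ⟪Ω, φ_β(Λf) φ_{δ†}(Λg) Ω⟫`,
  and of `twoPt (k,α)† (k,γ)` (`twoPt_cov'`), first on tensor products, then for all test
  functions of two arguments (`twoPt_comp_poincareTestMulti`, `twoPt_comp_poincareTestMulti'`);
* the **tube functions** `hW.tubeFn i j` (holomorphic on `𝒯₂` with boundary value `twoPt i j`,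
  `SpinorWightmanDistributions`), their translation invariance (`tubeFn_add_real`, uniqueness of
  boundary values), the difference-variable functions `hW.wFn i j = diffFn (tubeFn i j)` on the
  one-point tube (`tubeFn_eq_wFn`, `ForwardTubeTwoPoint`), and their covariance
  `wFn_lorentz` / `wFn_lorentz'`: `w_{αγ}(ζ) = ∑ S(A⁻¹)_{αβ} conj(S(A⁻¹)_{γδ}) w_{βδ}(Λ_ℂ ζ)`
  (the transformation law continued into the tube, S–W Thm. 3-5 / (4-43)).

## References

* R. F. Streater, A. S. Wightman, *PCT, Spin and Statistics, and All That* (1964; Princeton 2000),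
  §3-1 eq. (3-4), §3-3 eq. (3-26), Thm. 3-5, §4-4 eqs. (4-43), (4-51). [StreaterWightman1964]
-/

noncomputable section

open Filter MeasureTheory Set ComplexConjugate Complex
open _root_.Topology
open scoped InnerProductSpace SchwartzMap MatrixGroups
open Literature.MathematicalPhysics.QuantumLattice

namespace Literature.Analysis.FunctionSpaces

variable {κ : Type*} {W : SpinorWightmanData κ}

namespace IsSpinorWightmanQFT

open SpinorWightmanData

/-! ### The two-point distributions -/

/-- The **two-point distribution** `⟪Ω, φ_i(x₀) φ_j(x₁) Ω⟫ ∈ 𝒮'((ℝ⁴)²)` of two component letters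
(Streater–Wightman (1964), §3-3; the case `n = 2`, `Ψ = Ω` of `vectorDistribution`).
[cite: StreaterWightman1964, §3-3 eq. (3-19)] -/
abbrev twoPt (hW : IsSpinorWightmanQFT W) (i j : W.Idx) : 𝓢((Fin 2 → SpaceTime 3), ℂ) →L[ℂ] ℂ :=
  hW.vectorDistribution W.vacuum 2 ![i, j]

/-- On tensor products `f ⊗ g`, `twoPt i j (f ⊗ g) = ⟪Ω, φ_i(f) φ_j(g) Ω⟫`. [cite: StreaterWightman1964, §3-3 eq. (3-19)] -/
theorem twoPt_apply_tensor (hW : IsSpinorWightmanQFT W) (i j : W.Idx) {f g : 𝓢(SpaceTime 3, ℂ)}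
    {F : 𝓢((Fin 2 → SpaceTime 3), ℂ)} (hF : IsTensorOf F ![f, g]) :
    hW.twoPt i j F = ⟪W.vacuum, (W.cfield i f (W.cfield j g W.vacuumDom) : W.H)⟫_ℂ := by
  rw [hW.isSpinorVectorDistributionOf_vectorDistribution W.vacuum 2 ![i, j] ![f, g] F hF]
  congr 2

/-- `U(0, A) = U(0, A)`: the Poincaré operator at zero translation is the `SL(2, ℂ)` operator. [folklore] -/
theorem _root_.Literature.Analysis.FunctionSpaces.SpinorWightmanData.U_zero_left (W : SpinorWightmanData κ)
    (A : SL(2, ℂ)) : W.U 0 A = (W.spinRep A : W.H →L[ℂ] W.H) := by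
  simp [SpinorWightmanData.U]

/-- `U(0, A) U(0, A⁻¹) χ = χ`. [folklore] -/
theorem _root_.Literature.Analysis.FunctionSpaces.SpinorWightmanData.spinRep_apply_inv (W : SpinorWightmanData κ)
    (A : SL(2, ℂ)) (χ : W.H) :
    (W.spinRep A : W.H →L[ℂ] W.H) ((W.spinRep A⁻¹ : W.H →L[ℂ] W.H) χ) = χ := by
  change ((W.spinRep A * W.spinRep A⁻¹ : unitary (W.H →L[ℂ] W.H)) : W.H →L[ℂ] W.H) χ = χ
  rw [← map_mul, mul_inv_cancel, map_one]
  rfl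

/-- `⟪χ, U(0,A) v⟫ = ⟪U(0,A⁻¹) χ, v⟫` (unitarity). [folklore] -/
theorem _root_.Literature.Analysis.FunctionSpaces.SpinorWightmanData.inner_spinRep_right (W : SpinorWightmanData κ)
    (A : SL(2, ℂ)) (χ v : W.H) :
    ⟪χ, (W.spinRep A : W.H →L[ℂ] W.H) v⟫_ℂ = ⟪(W.spinRep A⁻¹ : W.H →L[ℂ] W.H) χ, v⟫_ℂ := by
  conv_lhs => rw [← W.spinRep_apply_inv A χ]
  exact ContinuousLinearMap.inner_map_map_of_mem_unitary (W.spinRep A).2 _ _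

/-- **`φ_{i††} = φ_i` on `D`**: the adjoint of the adjoint component acts as the original component
(W1 twice and density of `D`). [cite: StreaterWightman1964, §3-1] -/
theorem cfield_adj_adj (hW : IsSpinorWightmanQFT W) (i : W.Idx) (f : 𝓢(SpaceTime 3, ℂ)) (ψ : W.dom) :
    W.cfield (hW.adj (hW.adj i)) f ψ = W.cfield i f ψ := by
  apply Subtype.ext
  refine Dense.eq_of_inner_right ℂ hW.dense_dom fun v hv => ?_
  have h1 := hW.inner_cfield i f ψ ⟨v, hv⟩
  have h2 := hW.inner_cfield (hW.adj i) (starTest f) ⟨v, hv⟩ ψ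
  rw [starTest_starTest] at h2
  rw [h1, h2, starRingEnd_self_apply]

/-- Hermiticity read for the adjoint component: `⟪χ, φ_{i†}(f) ψ⟫ = conj ⟪ψ, φ_i(f̄) χ⟫`.
[cite: StreaterWightman1964, §3-1] -/
theorem inner_cfield_adj (hW : IsSpinorWightmanQFT W) (i : W.Idx) (f : 𝓢(SpaceTime 3, ℂ))
    (ψ χ : W.dom) :
    ⟪(χ : W.H), (W.cfield (hW.adj i) f ψ : W.H)⟫_ℂ =
      conj ⟪(ψ : W.H), (W.cfield i (starTest f) χ : W.H)⟫_ℂ := by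
  rw [hW.inner_cfield (hW.adj i) f ψ χ, hW.cfield_adj_adj]

/-- The pure Lorentz element `(0, Λ(A))` of the Poincaré group. [folklore] -/
abbrev gSL (A : SL(2, ℂ)) : PoincareGroup 3 := SemidirectProduct.inr (spinCoverHom A)

/-- **W2' at zero translation for the components**:
`U(0,A) φ_{k,α}(f) ψ = ∑_β S^{(k)}(A⁻¹)_{αβ} φ_{k,β}(Λ(A) • f) U(0,A) ψ`. [cite: StreaterWightman1964, §3-1 eq. (3-4)] -/
theorem spinRep_field (hW : IsSpinorWightmanQFT W) (A : SL(2, ℂ)) (k : κ) (α : Fin (W.mult k))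
    (f : 𝓢(SpaceTime 3, ℂ)) (ψ : W.dom) :
    (W.spinRep A : W.H →L[ℂ] W.H) (W.field k α f ψ : W.H) =
      ∑ β, W.S k A⁻¹ α β • (W.field k β (poincareTest (gSL A) f)
        ⟨(W.spinRep A : W.H →L[ℂ] W.H) ψ, hW.spinRep_dom A ψ ψ.2⟩ : W.H) := by
  have e : ∀ v : W.H, W.U 0 A v = (W.spinRep A : W.H →L[ℂ] W.H) v := fun v => by rw [W.U_zero_left]
  have hψ : W.U 0 A ψ ∈ W.dom := by rw [e]; exact hW.spinRep_dom A ψ ψ.2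
  have h := hW.covariant 0 A (spinCoverHom A) (coe_spinCoverHom A) k α f ψ hψ
  set Uψ : W.dom := ⟨W.U 0 A ψ, hψ⟩ with hUψ
  set Uψ' : W.dom := ⟨(W.spinRep A : W.H →L[ℂ] W.H) ψ, hW.spinRep_dom A ψ ψ.2⟩ with hUψ'
  have hU : Uψ' = Uψ := Subtype.ext (e ψ).symm
  rw [hU, ← e]
  exact h

/-- **Transformation law of the adjoint components**:
`U(0,A) φ_{(k,α)†}(f) ψ = ∑_β conj(S^{(k)}(A⁻¹)_{αβ}) φ_{(k,β)†}(Λ(A) • f) U(0,A) ψ` — the adjoint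
multiplet transforms under the complex conjugate representation (Streater–Wightman (1964), §3-1:
with `φ` the theory contains `φ*`, transforming under `S̄`). Proof: pair with `χ ∈ D`, move
`U(0,A)` and the fields across by unitarity and W1, use W2' for `φ_{k,α}`, and conclude by the
density of `D`. [cite: StreaterWightman1964, §3-1 eq. (3-4)] -/
theorem spinRep_cfield_adj (hW : IsSpinorWightmanQFT W) (A : SL(2, ℂ)) (k : κ) (α : Fin (W.mult k))
    (f : 𝓢(SpaceTime 3, ℂ)) (ψ : W.dom) :
    (W.spinRep A : W.H →L[ℂ] W.H) (W.cfield (hW.adj ⟨k, α⟩) f ψ : W.H) =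
      ∑ β, conj (W.S k A⁻¹ α β) • (W.cfield (hW.adj ⟨k, β⟩) (poincareTest (gSL A) f)
        ⟨(W.spinRep A : W.H →L[ℂ] W.H) ψ, hW.spinRep_dom A ψ ψ.2⟩ : W.H) := by
  set Uψ : W.dom := ⟨(W.spinRep A : W.H →L[ℂ] W.H) ψ, hW.spinRep_dom A ψ ψ.2⟩ with hUψ
  refine Dense.eq_of_inner_right ℂ hW.dense_dom fun v hv => ?_
  set χ' : W.dom := ⟨(W.spinRep A⁻¹ : W.H →L[ℂ] W.H) v, hW.spinRep_dom A⁻¹ v hv⟩ with hχ'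
  -- move `U` to the left and the adjoint field across
  rw [W.inner_spinRep_right, show (W.spinRep A⁻¹ : W.H →L[ℂ] W.H) v = (χ' : W.H) from rfl,
    hW.inner_cfield_adj ⟨k, α⟩ f ψ χ']
  -- `⟪ψ, φ_{k,α}(f̄) U⁻¹ v⟫ = ⟪Uψ, U φ_{k,α}(f̄) U⁻¹ v⟫` and W2'
  rw [← ContinuousLinearMap.inner_map_map_of_mem_unitary (W.spinRep A).2 (ψ : W.H),
    cfield_mk, hW.spinRep_field A k α (starTest f) χ']
  have hU : (⟨(W.spinRep A : W.H →L[ℂ] W.H) χ', hW.spinRep_dom A χ' χ'.2⟩ : W.dom) = ⟨v, hv⟩ :=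
    Subtype.ext (W.spinRep_apply_inv A v)
  rw [hU, inner_sum, inner_sum, map_sum]
  refine Finset.sum_congr rfl fun β _ => ?_
  rw [inner_smul_right, inner_smul_right, map_mul, ← WightmanFamily.starTest_poincareTest, ← cfield_mk,
    ← hW.inner_cfield_adj ⟨k, β⟩ (poincareTest (gSL A) f) Uψ ⟨v, hv⟩]

/-- **Covariance of the two-point distributions on tensor products** (Streater–Wightman (1964),
§3-3 eq. (3-26) for the pair `(φ_{k,α}, φ_{(k,γ)†})`):
`⟪Ω, φ_α(f) φ_{γ†}(g) Ω⟫ = ∑_{β,δ} S(A⁻¹)_{αβ} conj(S(A⁻¹)_{γδ}) ⟪Ω, φ_β(Λf) φ_{δ†}(Λg) Ω⟫`.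
[cite: StreaterWightman1964, §3-3 eq. (3-26)] -/
theorem twoPt_cov_tensor (hW : IsSpinorWightmanQFT W) (A : SL(2, ℂ)) (k : κ) (α γ : Fin (W.mult k))
    (f g : 𝓢(SpaceTime 3, ℂ)) :
    ⟪W.vacuum, (W.cfield ⟨k, α⟩ f (W.cfield (hW.adj ⟨k, γ⟩) g W.vacuumDom) : W.H)⟫_ℂ =
      ∑ β, ∑ δ, W.S k A⁻¹ α β * conj (W.S k A⁻¹ γ δ) *
        ⟪W.vacuum, (W.cfield ⟨k, β⟩ (poincareTest (gSL A) f)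
          (W.cfield (hW.adj ⟨k, δ⟩) (poincareTest (gSL A) g) W.vacuumDom) : W.H)⟫_ℂ := by
  have hΩ : (W.spinRep A : W.H →L[ℂ] W.H) W.vacuum = W.vacuum := hW.spinRep_vacuum A
  have hΩdom : (⟨(W.spinRep A : W.H →L[ℂ] W.H) W.vacuumDom, hW.spinRep_dom A _ W.vacuumDom.2⟩ : W.dom) =
      W.vacuumDom := Subtype.ext hΩ
  -- `⟪Ω, v⟫ = ⟪UΩ, Uv⟫ = ⟪Ω, Uv⟫`
  rw [← ContinuousLinearMap.inner_map_map_of_mem_unitary (W.spinRep A).2 W.vacuum, hΩ, cfield_mk,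
    hW.spinRep_field A k α f]
  -- the inner vector: transformation of the adjoint component applied to `Ω`
  have hinner : (⟨(W.spinRep A : W.H →L[ℂ] W.H) (W.cfield (hW.adj ⟨k, γ⟩) g W.vacuumDom),
      hW.spinRep_dom A _ (W.cfield (hW.adj ⟨k, γ⟩) g W.vacuumDom).2⟩ : W.dom) =
      ∑ δ, conj (W.S k A⁻¹ γ δ) • W.cfield (hW.adj ⟨k, δ⟩) (poincareTest (gSL A) g) W.vacuumDom := by
    apply Subtype.ext
    show (W.spinRep A : W.H →L[ℂ] W.H) (W.cfield (hW.adj ⟨k, γ⟩) g W.vacuumDom) = _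
    rw [hW.spinRep_cfield_adj A k γ g W.vacuumDom, hΩdom, Submodule.coe_sum]
    simp only [Submodule.coe_smul]
  rw [hinner, inner_sum]
  refine Finset.sum_congr rfl fun β _ => ?_
  rw [inner_smul_right, map_sum, Submodule.coe_sum, inner_sum, Finset.mul_sum]
  refine Finset.sum_congr rfl fun δ _ => ?_
  rw [map_smul, Submodule.coe_smul, inner_smul_right, cfield_mk, cfield_mk]
  ring

/-- The same for the pair `(φ_{(k,α)†}, φ_{k,γ})`:
`⟪Ω, φ_{α†}(f) φ_γ(g) Ω⟫ = ∑ conj(S(A⁻¹)_{αβ}) S(A⁻¹)_{γδ} ⟪Ω, φ_{β†}(Λf) φ_δ(Λg) Ω⟫`.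
[cite: StreaterWightman1964, §3-3 eq. (3-26)] -/
theorem twoPt_cov_tensor' (hW : IsSpinorWightmanQFT W) (A : SL(2, ℂ)) (k : κ) (α γ : Fin (W.mult k))
    (f g : 𝓢(SpaceTime 3, ℂ)) :
    ⟪W.vacuum, (W.cfield (hW.adj ⟨k, α⟩) f (W.cfield ⟨k, γ⟩ g W.vacuumDom) : W.H)⟫_ℂ =
      ∑ β, ∑ δ, conj (W.S k A⁻¹ α β) * W.S k A⁻¹ γ δ *
        ⟪W.vacuum, (W.cfield (hW.adj ⟨k, β⟩) (poincareTest (gSL A) f)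
          (W.cfield ⟨k, δ⟩ (poincareTest (gSL A) g) W.vacuumDom) : W.H)⟫_ℂ := by
  have hΩ : (W.spinRep A : W.H →L[ℂ] W.H) W.vacuum = W.vacuum := hW.spinRep_vacuum A
  have hΩdom : (⟨(W.spinRep A : W.H →L[ℂ] W.H) W.vacuumDom, hW.spinRep_dom A _ W.vacuumDom.2⟩ : W.dom) =
      W.vacuumDom := Subtype.ext hΩ
  rw [← ContinuousLinearMap.inner_map_map_of_mem_unitary (W.spinRep A).2 W.vacuum, hΩ,
    hW.spinRep_cfield_adj A k α f]
  have hinner : (⟨(W.spinRep A : W.H →L[ℂ] W.H) (W.cfield ⟨k, γ⟩ g W.vacuumDom),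
      hW.spinRep_dom A _ (W.cfield ⟨k, γ⟩ g W.vacuumDom).2⟩ : W.dom) =
      ∑ δ, W.S k A⁻¹ γ δ • W.cfield ⟨k, δ⟩ (poincareTest (gSL A) g) W.vacuumDom := by
    apply Subtype.ext
    show (W.spinRep A : W.H →L[ℂ] W.H) (W.cfield ⟨k, γ⟩ g W.vacuumDom) = _
    rw [cfield_mk, hW.spinRep_field A k γ g W.vacuumDom, hΩdom, Submodule.coe_sum]
    simp only [Submodule.coe_smul, cfield_mk]
  rw [hinner, inner_sum]
  refine Finset.sum_congr rfl fun β _ => ?_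
  rw [inner_smul_right, map_sum, Submodule.coe_sum, inner_sum, Finset.mul_sum]
  refine Finset.sum_congr rfl fun δ _ => ?_
  rw [map_smul, Submodule.coe_smul, inner_smul_right]
  ring

/-- **Covariance of the two-point distributions, all test functions**:
`twoPt (k,α) (k,γ)† = ∑ S(A⁻¹)_{αβ} conj(S(A⁻¹)_{γδ}) · twoPt (k,β) (k,δ)† ∘ (0, Λ(A))`
(from tensor products by the totality of tensor products). [cite: StreaterWightman1964, §3-3 eq. (3-26)] -/
theorem twoPt_comp_poincareTestMulti (hW : IsSpinorWightmanQFT W) (A : SL(2, ℂ)) (k : κ)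
    (α γ : Fin (W.mult k)) (F : 𝓢((Fin 2 → SpaceTime 3), ℂ)) :
    hW.twoPt ⟨k, α⟩ (hW.adj ⟨k, γ⟩) F =
      ∑ β, ∑ δ, W.S k A⁻¹ α β * conj (W.S k A⁻¹ γ δ) *
        hW.twoPt ⟨k, β⟩ (hW.adj ⟨k, δ⟩) (poincareTestMulti 2 (gSL A) F) := by
  set L : 𝓢((Fin 2 → SpaceTime 3), ℂ) →L[ℂ] ℂ := hW.twoPt ⟨k, α⟩ (hW.adj ⟨k, γ⟩) -
    ∑ β, ∑ δ, (W.S k A⁻¹ α β * conj (W.S k A⁻¹ γ δ)) •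
      (hW.twoPt ⟨k, β⟩ (hW.adj ⟨k, δ⟩)).comp (poincareTestMulti 2 (gSL A)) with hL
  suffices hL0 : L = 0 by
    have h := congrArg (fun T : 𝓢((Fin 2 → SpaceTime 3), ℂ) →L[ℂ] ℂ => T F) hL0
    simp only [hL, FunLike.coe_sub, FunLike.coe_sum,
      FunLike.coe_smul, ContinuousLinearMap.coe_comp, Pi.sub_apply, Finset.sum_apply,
      Pi.smul_apply, Function.comp_apply, smul_eq_mul, FunLike.coe_zero, Pi.zero_apply] at h
    exact sub_eq_zero.1 h
  refine SchwingerFamily.ext_of_denseSpan denseSpan_tensorProducts_holds fun f G hG => ?_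
  change L G = 0
  have hG' : IsTensorOf (poincareTestMulti 2 (gSL A) G) fun m => poincareTest (gSL A) (ofRealTest (f m)) :=
    hG.poincareTestMulti (gSL A)
  have hfg : (fun m => ofRealTest (f m)) = ![ofRealTest (f 0), ofRealTest (f 1)] := by
    funext m; fin_cases m <;> rfl
  have hfg' : (fun m => poincareTest (gSL A) (ofRealTest (f m))) =
      ![poincareTest (gSL A) (ofRealTest (f 0)), poincareTest (gSL A) (ofRealTest (f 1))] := by
    funext m; fin_cases m <;> rfl
  rw [hfg] at hG; rw [hfg'] at hG'
  simp only [hL, FunLike.coe_sub, FunLike.coe_sum,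
    FunLike.coe_smul, ContinuousLinearMap.coe_comp, Pi.sub_apply, Finset.sum_apply,
    Pi.smul_apply, Function.comp_apply, smul_eq_mul,
    hW.twoPt_apply_tensor _ _ hG, hW.twoPt_apply_tensor _ _ hG', hW.twoPt_cov_tensor A k α γ]
  exact sub_self _

/-- The same for `twoPt (k,α)† (k,γ)`. [cite: StreaterWightman1964, §3-3 eq. (3-26)] -/
theorem twoPt_comp_poincareTestMulti' (hW : IsSpinorWightmanQFT W) (A : SL(2, ℂ)) (k : κ)
    (α γ : Fin (W.mult k)) (F : 𝓢((Fin 2 → SpaceTime 3), ℂ)) :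
    hW.twoPt (hW.adj ⟨k, α⟩) ⟨k, γ⟩ F =
      ∑ β, ∑ δ, conj (W.S k A⁻¹ α β) * W.S k A⁻¹ γ δ *
        hW.twoPt (hW.adj ⟨k, β⟩) ⟨k, δ⟩ (poincareTestMulti 2 (gSL A) F) := by
  set L : 𝓢((Fin 2 → SpaceTime 3), ℂ) →L[ℂ] ℂ := hW.twoPt (hW.adj ⟨k, α⟩) ⟨k, γ⟩ -
    ∑ β, ∑ δ, (conj (W.S k A⁻¹ α β) * W.S k A⁻¹ γ δ) •
      (hW.twoPt (hW.adj ⟨k, β⟩) ⟨k, δ⟩).comp (poincareTestMulti 2 (gSL A)) with hL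
  suffices hL0 : L = 0 by
    have h := congrArg (fun T : 𝓢((Fin 2 → SpaceTime 3), ℂ) →L[ℂ] ℂ => T F) hL0
    simp only [hL, FunLike.coe_sub, FunLike.coe_sum,
      FunLike.coe_smul, ContinuousLinearMap.coe_comp, Pi.sub_apply, Finset.sum_apply,
      Pi.smul_apply, Function.comp_apply, smul_eq_mul, FunLike.coe_zero, Pi.zero_apply] at h
    exact sub_eq_zero.1 h
  refine SchwingerFamily.ext_of_denseSpan denseSpan_tensorProducts_holds fun f G hG => ?_
  change L G = 0
  have hG' : IsTensorOf (poincareTestMulti 2 (gSL A) G) fun m => poincareTest (gSL A) (ofRealTest (f m)) :=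
    hG.poincareTestMulti (gSL A)
  have hfg : (fun m => ofRealTest (f m)) = ![ofRealTest (f 0), ofRealTest (f 1)] := by
    funext m; fin_cases m <;> rfl
  have hfg' : (fun m => poincareTest (gSL A) (ofRealTest (f m))) =
      ![poincareTest (gSL A) (ofRealTest (f 0)), poincareTest (gSL A) (ofRealTest (f 1))] := by
    funext m; fin_cases m <;> rfl
  rw [hfg] at hG; rw [hfg'] at hG'
  simp only [hL, FunLike.coe_sub, FunLike.coe_sum,
    FunLike.coe_smul, ContinuousLinearMap.coe_comp, Pi.sub_apply, Finset.sum_apply,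
    Pi.smul_apply, Function.comp_apply, smul_eq_mul,
    hW.twoPt_apply_tensor _ _ hG, hW.twoPt_apply_tensor _ _ hG', hW.twoPt_cov_tensor' A k α γ]
  exact sub_self _

/-! ### Translation invariance -/

/-- **Translation invariance of the two-point distributions**: `twoPt i j ((a,1) • F) = twoPt i j F`
(W2' at `A = 1` and `U(a) Ω = Ω`). [cite: StreaterWightman1964, §3-3 eq. (3-21)] -/
theorem twoPt_transl (hW : IsSpinorWightmanQFT W) (i j : W.Idx) (a : SpaceTime 3)
    (F : 𝓢((Fin 2 → SpaceTime 3), ℂ)) :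
    hW.twoPt i j (poincareTestMulti 2 (SemidirectProduct.inl (Multiplicative.ofAdd a)) F) = hW.twoPt i j F := by
  set g : PoincareGroup 3 := SemidirectProduct.inl (Multiplicative.ofAdd a) with hg
  set L : 𝓢((Fin 2 → SpaceTime 3), ℂ) →L[ℂ] ℂ := (hW.twoPt i j).comp (poincareTestMulti 2 g) - hW.twoPt i j
    with hL
  suffices hL0 : L = 0 by
    have h := congrArg (fun T : 𝓢((Fin 2 → SpaceTime 3), ℂ) →L[ℂ] ℂ => T F) hL0
    simpa [hL, sub_eq_zero] using h
  refine SchwingerFamily.ext_of_denseSpan denseSpan_tensorProducts_holds fun f G hG => ?_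
  change L G = 0
  have hG' : IsTensorOf (poincareTestMulti 2 g G) fun m => poincareTest g (ofRealTest (f m)) :=
    hG.poincareTestMulti g
  have hfg : (fun m => ofRealTest (f m)) = ![ofRealTest (f 0), ofRealTest (f 1)] := by
    funext m; fin_cases m <;> rfl
  have hfg' : (fun m => poincareTest g (ofRealTest (f m))) =
      ![poincareTest g (ofRealTest (f 0)), poincareTest g (ofRealTest (f 1))] := by
    funext m; fin_cases m <;> rfl
  rw [hfg] at hG; rw [hfg'] at hG'
  simp only [hL, FunLike.coe_sub, ContinuousLinearMap.coe_comp, Pi.sub_apply,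
    Function.comp_apply, hW.twoPt_apply_tensor _ _ hG, hW.twoPt_apply_tensor _ _ hG']
  -- `φ_i(f_a) φ_j(g_a) Ω = U(a) φ_i(f) φ_j(g) Ω` and `⟪Ω, U(a) v⟫ = ⟪Ω, v⟫`
  have h := hW.transl_cmonomialVec a [(i, ofRealTest (f 0)), (j, ofRealTest (f 1))]
  simp only [List.map_cons, List.map_nil, SpinorWightmanData.translateLetter, cmonomialVec_cons,
    cmonomialVec_nil] at h
  rw [← hg] at h
  rw [← h]
  have hΩ : W.transl (Multiplicative.ofAdd a) W.vacuum = W.vacuum :=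
    (W.transl.mem_invariantVectors_iff W.vacuum).1 hW.uniqueVacuum.1.1 _
  rw [show ∀ v : W.H, ⟪W.vacuum, W.transl (Multiplicative.ofAdd a) v⟫_ℂ =
      ⟪W.transl (Multiplicative.ofAdd a) W.vacuum, W.transl (Multiplicative.ofAdd a) v⟫_ℂ from
      fun v => by rw [hΩ],
    Literature.Analysis.UnboundedOperators.UnitaryRep.inner_map_map, sub_self]

/-! ### Tube functions and their covariance -/

/-- Existence of the two-point tube function (spectral condition + Fourier–Laplace,
`SpinorWightmanDistributions`). [cite: StreaterWightman1964, Thm 3-5] -/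
theorem exists_tubeFn (hW : IsSpinorWightmanQFT W) (i j : W.Idx) :
    ∃ G : (Fin 2 → Fin (3 + 1) → ℂ) → ℂ,
      DifferentiableOn ℂ G (forwardTube 3 2) ∧ HasDistributionalBoundaryValue G (hW.twoPt i j) :=
  hW.exists_vectorTubeFunction W.vacuum 2 ![i, j]

/-- **The two-point tube function** `G_{ij}`: holomorphic on `𝒯₂` with boundary value
`⟪Ω, φ_i(x₀) φ_j(x₁) Ω⟫` (Streater–Wightman (1964), Thm. 3-5 / (4-43)). [cite: StreaterWightman1964, Thm 3-5] -/
def tubeFn (hW : IsSpinorWightmanQFT W) (i j : W.Idx) : (Fin 2 → Fin (3 + 1) → ℂ) → ℂ :=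
  (hW.exists_tubeFn i j).choose

/-- `G_{ij}` is holomorphic on `𝒯₂`. [cite: StreaterWightman1964, Thm 3-5] -/
theorem differentiableOn_tubeFn (hW : IsSpinorWightmanQFT W) (i j : W.Idx) :
    DifferentiableOn ℂ (hW.tubeFn i j) (forwardTube 3 2) :=
  (hW.exists_tubeFn i j).choose_spec.1

/-- `G_{ij}` has boundary value `twoPt i j`. [cite: StreaterWightman1964, Thm 3-5] -/
theorem hasDistributionalBoundaryValue_tubeFn (hW : IsSpinorWightmanQFT W) (i j : W.Idx) :
    HasDistributionalBoundaryValue (hW.tubeFn i j) (hW.twoPt i j) :=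
  (hW.exists_tubeFn i j).choose_spec.2

/-- **Translation invariance of the tube function** (real translations; from `twoPt_transl` and
uniqueness of boundary values on `𝒯₂`). [cite: StreaterWightman1964, Thm 3-5] -/
theorem tubeFn_add_real (hW : IsSpinorWightmanQFT W) (i j : W.Idx) (a : SpaceTime 3) :
    ∀ z ∈ forwardTube 3 2, hW.tubeFn i j (fun k => z k + complexifyPoint a) = hW.tubeFn i j z := by
  intro z hz
  have hd : DifferentiableOn ℂ (fun z : Fin 2 → Fin (3 + 1) → ℂ => hW.tubeFn i j (fun k => z k + complexifyPoint a))
      (forwardTube 3 2) := by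
    refine (hW.differentiableOn_tubeFn i j).comp ?_ fun w hw => add_complexifyPoint_mem_forwardTube hw a
    exact (differentiable_pi.2 fun k => (differentiable_apply k).add (differentiable_const _)).differentiableOn
  have hb := (hW.hasDistributionalBoundaryValue_tubeFn i j).comp_add_real a
  have hTeq : (hW.twoPt i j).comp (poincareTestMulti 2 (SemidirectProduct.inl (Multiplicative.ofAdd a))) =
      hW.twoPt i j := by
    ext G; exact hW.twoPt_transl i j a G
  rw [hTeq] at hb
  exact eqOn_forwardTube_of_hasDistributionalBoundaryValue hd (hW.differentiableOn_tubeFn i j) hb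
    (hW.hasDistributionalBoundaryValue_tubeFn i j) hz

/-- **The two-point function in the difference variable** `w_{ij}(ζ) = G_{ij}(p₀, p₀ + ζ)`
(Streater–Wightman (1964), (4-43)). [cite: StreaterWightman1964, §4-4 eq. (4-43)] -/
def wFn (hW : IsSpinorWightmanQFT W) (i j : W.Idx) : (Fin (3 + 1) → ℂ) → ℂ := diffFn (hW.tubeFn i j)

/-- `w_{ij}` is holomorphic on the upper tube `T⁺ = {Im ζ ∈ V₊}`. [cite: StreaterWightman1964, §4-4 eq. (4-43)] -/
theorem differentiableOn_wFn (hW : IsSpinorWightmanQFT W) (i j : W.Idx) :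
    DifferentiableOn ℂ (hW.wFn i j) TubeBoost.upperTube :=
  differentiableOn_diffFn (hW.differentiableOn_tubeFn i j)

/-- `G_{ij}(z₀, z₁) = w_{ij}(z₁ − z₀)` on `𝒯₂`. [cite: StreaterWightman1964, §4-4 eq. (4-43)] -/
theorem tubeFn_eq_wFn (hW : IsSpinorWightmanQFT W) (i j : W.Idx) {z : Fin 2 → Fin (3 + 1) → ℂ}
    (hz : z ∈ forwardTube 3 2) : hW.tubeFn i j z = hW.wFn i j (z 1 - z 0) :=
  apply_eq_diffFn (hW.differentiableOn_tubeFn i j) (hW.tubeFn_add_real i j) hz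

/-- `w_{ij}(ζ) = G_{ij}(p₀, p₀ + ζ)` (unfolding). [folklore] -/
theorem wFn_eq (hW : IsSpinorWightmanQFT W) (i j : W.Idx) (ζ : Fin (3 + 1) → ℂ) :
    hW.wFn i j ζ = hW.tubeFn i j (Literature.MathematicalPhysics.QuantumLattice.twoPt ζ) := rfl

section Lorentz

variable (hW : IsSpinorWightmanQFT W)

/-- The real Lorentz transformation `Λ(A)` as a continuous linear equivalence. [folklore] -/
abbrev ΛL (A : SL(2, ℂ)) : SpaceTime 3 ≃L[ℝ] SpaceTime 3 :=
  (spinCoverHom A : SpaceTime 3 ≃L[ℝ] SpaceTime 3)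

/-- **Uniqueness step for a covariant family**: if `G` is holomorphic on `𝒯₂` with boundary value
`T`, the `G_{m}` are holomorphic on `𝒯₂` with boundary values `T_m`, and
`T = ∑_m c_m · T_m ∘ (0, Λ)`, then `G(z) = ∑_m c_m G_m(Λ_ℂ z)` on `𝒯₂` (boundary value of the
Lorentz-transformed functions, `HasDistributionalBoundaryValue.comp_lorentz`, and S–W Thm. 2-17).
[cite: StreaterWightman1964, Thm 3-5] -/
theorem eq_sum_comp_lorentz_of_bv {ι : Type*} [Fintype ι] {G : (Fin 2 → Fin (3 + 1) → ℂ) → ℂ}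
    {T : 𝓢((Fin 2 → SpaceTime 3), ℂ) →L[ℂ] ℂ} (hG : DifferentiableOn ℂ G (forwardTube 3 2))
    (hbv : HasDistributionalBoundaryValue G T) (c : ι → ℂ) {Gm : ι → (Fin 2 → Fin (3 + 1) → ℂ) → ℂ}
    {Tm : ι → 𝓢((Fin 2 → SpaceTime 3), ℂ) →L[ℂ] ℂ} (hGm : ∀ m, DifferentiableOn ℂ (Gm m) (forwardTube 3 2))
    (hbvm : ∀ m, HasDistributionalBoundaryValue (Gm m) (Tm m)) (Λ : restrictedLorentzGroup 3)
    (hT : ∀ F, T F = ∑ m, c m * Tm m (poincareTestMulti 2 (SemidirectProduct.inr Λ) F))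
    {z : Fin 2 → Fin (3 + 1) → ℂ} (hz : z ∈ forwardTube 3 2) :
    G z = ∑ m, c m * Gm m (fun k => lorentzActC (Λ : SpaceTime 3 ≃L[ℝ] SpaceTime 3) (z k)) := by
  set GΛ : ι → (Fin 2 → Fin (3 + 1) → ℂ) → ℂ := fun m z =>
    Gm m (fun k => lorentzActC (Λ : SpaceTime 3 ≃L[ℝ] SpaceTime 3) (z k)) with hGΛ
  have hdΛ : ∀ m, DifferentiableOn ℂ (GΛ m) (forwardTube 3 2) := fun m =>
    (hGm m).comp (Literature.MathematicalPhysics.QuantumFieldTheory.differentiable_lorentzActC_diag _).differentiableOn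
      fun w hw => Literature.MathematicalPhysics.QuantumFieldTheory.lorentzActC_mem_forwardTube_holds Λ hw
  have hbΛ : ∀ m, HasDistributionalBoundaryValue (GΛ m)
      ((Tm m).comp (poincareTestMulti 2 (SemidirectProduct.inr Λ))) := fun m => (hbvm m).comp_lorentz Λ
  set D : (Fin 2 → Fin (3 + 1) → ℂ) → ℂ := fun z => G z - ∑ m, c m * GΛ m z with hD
  have hDd : DifferentiableOn ℂ D (forwardTube 3 2) :=
    hG.sub (DifferentiableOn.fun_sum (u := Finset.univ) (A := fun m z => c m * GΛ m z)
      fun m _ => (differentiableOn_const (c m)).mul (hdΛ m))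
  have hD0 : ∀ z ∈ forwardTube 3 2, D z = 0 := by
    refine eq_zero_of_distributionalBoundaryValue_zero_holds D hDd ?_
    intro η hη F hF
    have hlim := (hbv η hη F).sub (tendsto_finsetSum (Finset.univ : Finset ι)
      fun m _ => ((hbΛ m) η hη F).const_mul (c m))
    simp only [ContinuousLinearMap.coe_comp, Function.comp_apply] at hlim
    rw [← hT F, sub_self] at hlim
    refine hlim.congr' ?_
    filter_upwards [self_mem_nhdsWithin] with t ht
    have hint := fun m => integrable_ray_mul (hdΛ m) hη ht hF
    simp_rw [← MeasureTheory.integral_const_mul]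
    rw [← integral_finsetSum _ fun m _ => (hint m).const_mul (c m),
      ← integral_sub (integrable_ray_mul hG hη ht hF) (integrable_finsetSum _ fun m _ => (hint m).const_mul (c m))]
    refine integral_congr_ae (Eventually.of_forall fun x => ?_)
    simp only [hD, sub_mul, Finset.sum_mul, mul_assoc]
  have h := hD0 z hz
  simp only [hD, sub_eq_zero] at h
  exact h

/-- **Lorentz covariance of the tube functions** (S–W Thm. 3-5 with the transformation law (3-26),
pair `(φ_{k,α}, φ_{(k,γ)†})`):
`G_{αγ†}(z) = ∑_{β,δ} S(A⁻¹)_{αβ} conj(S(A⁻¹)_{γδ}) G_{βδ†}(Λ(A)_ℂ z)` on `𝒯₂`. [cite: StreaterWightman1964, Thm 3-5] -/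
theorem tubeFn_lorentz (A : SL(2, ℂ)) (k : κ) (α γ : Fin (W.mult k)) {z : Fin 2 → Fin (3 + 1) → ℂ}
    (hz : z ∈ forwardTube 3 2) :
    hW.tubeFn ⟨k, α⟩ (hW.adj ⟨k, γ⟩) z = ∑ p : Fin (W.mult k) × Fin (W.mult k),
      (W.S k A⁻¹ α p.1 * conj (W.S k A⁻¹ γ p.2)) *
        hW.tubeFn ⟨k, p.1⟩ (hW.adj ⟨k, p.2⟩) (fun m => lorentzActC (ΛL A) (z m)) := by
  refine eq_sum_comp_lorentz_of_bv (hW.differentiableOn_tubeFn _ _) (hW.hasDistributionalBoundaryValue_tubeFn _ _)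
    (fun p : Fin (W.mult k) × Fin (W.mult k) => W.S k A⁻¹ α p.1 * conj (W.S k A⁻¹ γ p.2))
    (fun p => hW.differentiableOn_tubeFn _ _) (fun p => hW.hasDistributionalBoundaryValue_tubeFn _ _)
    (spinCoverHom A) (fun F => ?_) hz
  rw [hW.twoPt_comp_poincareTestMulti A k α γ F, ← Finset.sum_product']
  rfl

/-- The same for the pair `(φ_{(k,α)†}, φ_{k,γ})`:
`G_{α†γ}(z) = ∑ conj(S(A⁻¹)_{αβ}) S(A⁻¹)_{γδ} G_{β†δ}(Λ(A)_ℂ z)`. [cite: StreaterWightman1964, Thm 3-5] -/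
theorem tubeFn_lorentz' (A : SL(2, ℂ)) (k : κ) (α γ : Fin (W.mult k)) {z : Fin 2 → Fin (3 + 1) → ℂ}
    (hz : z ∈ forwardTube 3 2) :
    hW.tubeFn (hW.adj ⟨k, α⟩) ⟨k, γ⟩ z = ∑ p : Fin (W.mult k) × Fin (W.mult k),
      (conj (W.S k A⁻¹ α p.1) * W.S k A⁻¹ γ p.2) *
        hW.tubeFn (hW.adj ⟨k, p.1⟩) ⟨k, p.2⟩ (fun m => lorentzActC (ΛL A) (z m)) := by
  refine eq_sum_comp_lorentz_of_bv (hW.differentiableOn_tubeFn _ _) (hW.hasDistributionalBoundaryValue_tubeFn _ _)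
    (fun p : Fin (W.mult k) × Fin (W.mult k) => conj (W.S k A⁻¹ α p.1) * W.S k A⁻¹ γ p.2)
    (fun p => hW.differentiableOn_tubeFn _ _) (fun p => hW.hasDistributionalBoundaryValue_tubeFn _ _)
    (spinCoverHom A) (fun F => ?_) hz
  rw [hW.twoPt_comp_poincareTestMulti' A k α γ F, ← Finset.sum_product']
  rfl

/-- `Λ_ℂ` acts on the difference variable: `(Λ_ℂ ∘ twoPt ζ) 1 − (Λ_ℂ ∘ twoPt ζ) 0 = Λ_ℂ ζ`. [folklore] -/
theorem lorentzActC_twoPt_sub (Λ : SpaceTime 3 ≃L[ℝ] SpaceTime 3) (ζ : Fin (3 + 1) → ℂ) :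
    lorentzActC Λ (Literature.MathematicalPhysics.QuantumLattice.twoPt ζ 1) - lorentzActC Λ (Literature.MathematicalPhysics.QuantumLattice.twoPt ζ 0) = lorentzActC Λ ζ := by
  rw [twoPt_one, twoPt_zero, ← Literature.MathematicalPhysics.QuantumFieldTheory.lorentzActC_sub, add_sub_cancel_left]

/-- **Lorentz covariance of the difference-variable functions** on `T⁺`:
`w_{αγ†}(ζ) = ∑ S(A⁻¹)_{αβ} conj(S(A⁻¹)_{γδ}) w_{βδ†}(Λ(A)_ℂ ζ)`. [cite: StreaterWightman1964, §4-4 eq. (4-43)] -/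
theorem wFn_lorentz (A : SL(2, ℂ)) (k : κ) (α γ : Fin (W.mult k)) {ζ : Fin (3 + 1) → ℂ}
    (hζ : ζ ∈ TubeBoost.upperTube) :
    hW.wFn ⟨k, α⟩ (hW.adj ⟨k, γ⟩) ζ = ∑ p : Fin (W.mult k) × Fin (W.mult k),
      (W.S k A⁻¹ α p.1 * conj (W.S k A⁻¹ γ p.2)) * hW.wFn ⟨k, p.1⟩ (hW.adj ⟨k, p.2⟩) (lorentzActC (ΛL A) ζ) := by
  have hz : Literature.MathematicalPhysics.QuantumLattice.twoPt ζ ∈ forwardTube 3 2 := (twoPt_mem_forwardTube_iff ζ).2 hζ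
  rw [wFn_eq, hW.tubeFn_lorentz A k α γ hz]
  refine Finset.sum_congr rfl fun p _ => ?_
  rw [hW.tubeFn_eq_wFn _ _ (Literature.MathematicalPhysics.QuantumFieldTheory.lorentzActC_mem_forwardTube_holds (spinCoverHom A) hz), lorentzActC_twoPt_sub]

/-- The same for `w_{α†γ}`. [cite: StreaterWightman1964, §4-4 eq. (4-43)] -/
theorem wFn_lorentz' (A : SL(2, ℂ)) (k : κ) (α γ : Fin (W.mult k)) {ζ : Fin (3 + 1) → ℂ}
    (hζ : ζ ∈ TubeBoost.upperTube) :
    hW.wFn (hW.adj ⟨k, α⟩) ⟨k, γ⟩ ζ = ∑ p : Fin (W.mult k) × Fin (W.mult k),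
      (conj (W.S k A⁻¹ α p.1) * W.S k A⁻¹ γ p.2) * hW.wFn (hW.adj ⟨k, p.1⟩) ⟨k, p.2⟩ (lorentzActC (ΛL A) ζ) := by
  have hz : Literature.MathematicalPhysics.QuantumLattice.twoPt ζ ∈ forwardTube 3 2 := (twoPt_mem_forwardTube_iff ζ).2 hζ
  rw [wFn_eq, hW.tubeFn_lorentz' A k α γ hz]
  refine Finset.sum_congr rfl fun p _ => ?_
  rw [hW.tubeFn_eq_wFn _ _ (Literature.MathematicalPhysics.QuantumFieldTheory.lorentzActC_mem_forwardTube_holds (spinCoverHom A) hz), lorentzActC_twoPt_sub]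

end Lorentz

/-! ### The boosts along the third axis and the rotation by `π` about it -/

/-- The real boost of rapidity `χ` along the third axis. [cite: StreaterWightman1964, §1-3 eq. (1-10)] -/
def realBoost (χ : ℝ) (x : SpaceTime 3) : SpaceTime 3 :=
  WithLp.toLp 2 fun μ => if μ = 0 then Real.cosh χ * x 0 + Real.sinh χ * x 3
    else if μ = 3 then Real.sinh χ * x 0 + Real.cosh χ * x 3 else x μ

/-- Components of `realBoost`. [folklore] -/
theorem realBoost_apply (χ : ℝ) (x : SpaceTime 3) (μ : Fin (3 + 1)) :
    realBoost χ x μ = if μ = 0 then Real.cosh χ * x 0 + Real.sinh χ * x 3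
      else if μ = 3 then Real.sinh χ * x 0 + Real.cosh χ * x 3 else x μ := rfl

/-- **`Λ(diag(e^{χ/2}, e^{−χ/2}))` is the boost of rapidity `χ` along the third axis**
(Streater–Wightman (1964), §1-3, eqs. (1-10), (1-14)). [cite: StreaterWightman1964, §1-3 eq. (1-10)] -/
theorem spinActFun_diag {A : SL(2, ℂ)} {χ : ℝ}
    (hA : (A : Matrix (Fin 2) (Fin 2) ℂ) = !![(Real.exp (χ / 2) : ℂ), 0; 0, (Real.exp (-(χ / 2)) : ℂ)])
    (x : SpaceTime 3) : spinActFun A x = realBoost χ x := by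
  apply toHermitian_injective
  rw [toHermitian_spinActFun, hA, toHermitian_eq, toHermitian_eq]
  have hc : ∀ r : ℝ, (starRingEnd ℂ) (cexp (r : ℂ)) = cexp r := fun r => by
    rw [← Complex.exp_conj, Complex.conj_ofReal]
  have e1 : ((χ : ℂ) / 2) = ((χ / 2 : ℝ) : ℂ) := by push_cast; ring
  have e2 : (-((χ : ℂ) / 2)) = ((-(χ / 2) : ℝ) : ℂ) := by push_cast; ring
  have h1 : cexp ((χ : ℂ) / 2) * (starRingEnd ℂ) (cexp ((χ : ℂ) / 2)) = Complex.cosh χ + Complex.sinh χ := by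
    rw [e1, hc, ← Complex.exp_add, Complex.cosh_add_sinh]; push_cast; ring_nf
  have h2 : cexp (-((χ : ℂ) / 2)) * (starRingEnd ℂ) (cexp (-((χ : ℂ) / 2))) = Complex.cosh χ - Complex.sinh χ := by
    rw [e2, hc, ← Complex.exp_add, Complex.cosh_sub_sinh]; push_cast; ring_nf
  have h3 : cexp ((χ : ℂ) / 2) * (starRingEnd ℂ) (cexp (-((χ : ℂ) / 2))) = 1 := by
    rw [e2, hc, ← Complex.exp_add]; push_cast; ring_nf; exact Complex.exp_zero
  have h4 : cexp (-((χ : ℂ) / 2)) * (starRingEnd ℂ) (cexp ((χ : ℂ) / 2)) = 1 := by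
    rw [e1, hc, ← Complex.exp_add]; push_cast; ring_nf; exact Complex.exp_zero
  ext i j
  fin_cases i <;> fin_cases j
  · simp [Matrix.mul_apply, Fin.sum_univ_two, Matrix.conjTranspose_apply, realBoost_apply]
    linear_combination ((x 0 : ℂ) + x 3) * h1
  · simp [Matrix.mul_apply, Fin.sum_univ_two, Matrix.conjTranspose_apply, realBoost_apply]
    linear_combination ((x 1 : ℂ) - I * x 2) * h3
  · simp [Matrix.mul_apply, Fin.sum_univ_two, Matrix.conjTranspose_apply, realBoost_apply]
    linear_combination ((x 1 : ℂ) + I * x 2) * h4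
  · simp [Matrix.mul_apply, Fin.sum_univ_two, Matrix.conjTranspose_apply, realBoost_apply]
    linear_combination ((x 0 : ℂ) - x 3) * h2

/-- **The complexified `Λ(diag(e^{χ/2}, e^{−χ/2}))` is the light-cone boost** `TubeBoost.boost χ`:
`u ↦ e^{χ} u`, `v ↦ e^{−χ} v`, transverse components fixed. [cite: StreaterWightman1964, §1-3 eq. (1-10)] -/
theorem lorentzActC_diag {A : SL(2, ℂ)} {χ : ℝ}
    (hA : (A : Matrix (Fin 2) (Fin 2) ℂ) = !![(Real.exp (χ / 2) : ℂ), 0; 0, (Real.exp (-(χ / 2)) : ℂ)])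
    (ζ : Fin (3 + 1) → ℂ) : lorentzActC (ΛL A) ζ = TubeBoost.boost χ ζ := by
  have hΛ : ∀ x, (ΛL A) x = realBoost χ x := fun x => by
    rw [show (ΛL A) x = spinActFun A x from congrFun (coe_spinCoverHom A) x, spinActFun_diag hA]
  funext μ
  rw [Literature.MathematicalPhysics.QuantumFieldTheory.lorentzActC_apply_eq_sum]
  simp only [hΛ, realBoost_apply, Fin.isValue, TubeBoost.boost, TubeBoost.lcU, TubeBoost.lcV]
  fin_cases μ <;> simp [Fin.sum_univ_succ, PiLp.single_apply] <;>
    simp only [Complex.cosh, Complex.sinh] <;> ring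

/-- The element `J = diag(i, −i) ∈ SL(2, ℂ)` covering the rotation by `π` about the third axis.
[cite: StreaterWightman1964, §1-3 eq. (1-14)] -/
def Jrot : SL(2, ℂ) := ⟨!![I, 0; 0, -I], by simp [Matrix.det_fin_two]⟩

/-- Coercion of `Jrot`. [folklore] -/
@[simp] theorem coe_Jrot : (Jrot : Matrix (Fin 2) (Fin 2) ℂ) = !![I, 0; 0, -I] := rfl

/-- The rotation by `π` about the third axis, `(x⁰, x¹, x², x³) ↦ (x⁰, −x¹, −x², x³)`. [folklore] -/
def realRot3 (x : SpaceTime 3) : SpaceTime 3 :=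
  WithLp.toLp 2 fun μ => if μ = 1 ∨ μ = 2 then -x μ else x μ

/-- Components of `realRot3`. [folklore] -/
theorem realRot3_apply (x : SpaceTime 3) (μ : Fin (3 + 1)) :
    realRot3 x μ = if μ = 1 ∨ μ = 2 then -x μ else x μ := rfl

/-- **`Λ(J)` is the rotation by `π` about the third axis.** [cite: StreaterWightman1964, §1-3 eq. (1-14)] -/
theorem spinActFun_Jrot (x : SpaceTime 3) : spinActFun Jrot x = realRot3 x := by
  apply toHermitian_injective
  rw [toHermitian_spinActFun, coe_Jrot, toHermitian_eq, toHermitian_eq]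
  ext i j
  fin_cases i <;> fin_cases j <;>
    simp [Matrix.mul_apply, Fin.sum_univ_two, Matrix.conjTranspose_apply, realRot3_apply] <;> ring_nf <;>
    simp [Complex.I_sq] <;> ring

/-- **The complexified `Λ(J)` is `TubeBoost.rot3`.** [cite: StreaterWightman1964, §1-3 eq. (1-14)] -/
theorem lorentzActC_Jrot (ζ : Fin (3 + 1) → ℂ) : lorentzActC (ΛL Jrot) ζ = TubeBoost.rot3 ζ := by
  have hΛ : ∀ x, (ΛL Jrot) x = realRot3 x := fun x => by
    rw [show (ΛL Jrot) x = spinActFun Jrot x from congrFun (coe_spinCoverHom Jrot) x, spinActFun_Jrot]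
  funext μ
  rw [Literature.MathematicalPhysics.QuantumFieldTheory.lorentzActC_apply_eq_sum]
  simp only [hΛ, realRot3_apply, Fin.isValue, TubeBoost.rot3]
  fin_cases μ <;>
    simp [PiLp.single_apply, apply_ite, ite_mul, Finset.sum_ite_eq]

end IsSpinorWightmanQFT

end Literature.Analysis.FunctionSpaces
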